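import Summits.BirchSwinnertonDyer.Rank1Residual.Additive.TameBranchAnalyticShaConverseTwins
import HarnessLib

/-!
# `BSD(E,p)` ⟺ THE MAIN CONJECTURE AT THE PAIR on X3♯(G-ord, `e = 2`) ∩ `I₀*` (`E[p]` reducible) — the
# class-level MASTER for the Wuthrich element (`ord_p #Ш[p^∞] + ord_p ℓ ≤ ord_p #Ш_an`, `=` iff it generates),
# `BSD(E,p)` ⟹ MC(pair), and MC(pair) ⟹ `BSD(E,p)` off the anomalous rows, EVERY odd `p`
# (cell `b2b-bsdres`, sub-cell additive-p2 = X3♯(G-ord)/X4♯(G-ord), gen 33; part 6b)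

HONEST FRAMING (cell `b2b-bsdres`, run/shared/lean/b2b/bsd-rank1-residual/, verbatim in every
file): the goal of the cell is to DELETE the COMBINATION-SHAPED residual classes of the
Birch–Swinnerton-Dyer formula for ALL analytic-rank `≤ 1` elliptic curves over `ℚ` — "full BSD
formula for every rank `≤ 1` curve in class `C`" assembled STRICTLY from published theorems — so
that the rank-`≤ 1` remainder becomes exactly the CONSTRUCTION-SHAPED classes, which are TYPED
(missing-input `Prop`s), NOT attempted. This is not "finishing BSD". Sub-cell additive-p2: the
classes X3♯(G-ord) / X4♯(G-ord) are CONSTRUCTION-SHAPED and stay so; labels / RESIDUAL-MAP marks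
UNCHANGED; nothing is booked (`BSD(E,p)` and "the element generates" enter ONLY as hypotheses of the
two directions). Theorems only; published inputs are explicit binders (`hWu` Wuthrich 2014 Thm. 16 —
no image hypothesis —, `hGZK`, `hmod`, the (B)-datum `LeadingTermClauses W p Dh` = A175 at `p ≥ 5` /
`mainTheorem_three` at `p = 3`). No definition, no named fact, no `sorry`.

## What and why

Sibling of `TameBranchAnalyticShaConverseTwinsIff.lean` (part 6a: X4(M), X3♯(M)); see its docstring. Here
the X3♯(G-ord, `e = 2`) ∩ `I₀*` cell (census: 154 + 14 + 5 rank-0 rows at `p = 3, 5, 7`; `3 ∣ #Ш_an` on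
7632m1, 19530cg1): `ClassX3Gord.padicVal_sha_add_le_shaAn_and_iff_rankZero` (MASTER: Wuthrich element `g`,
`ι g = u·ϖ·B^±_{(p−1)/2}(f♭, α)`, Delbourgo's `ℓ ∣ p²`, `ord_p #Ш[p^∞] + ord_p ℓ ≤ ord_p #Ш_an`, `=` ⟺
`char_Λ X = (g)`), `…charIdeal_eq_span_wuthrich_of_bsdp_rankZero` (**`BSD(E,p)` ⟹ the Wuthrich element
generates**), `…bsdp_of_charIdeal_eq_span_wuthrich_rankZero` (**MC(pair) ⟹ `BSD(E,p)` off the anomalous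
rows**) — from gen 32's series-agnostic `padicVal_sha_add_le_and_iff_of_iota_eq_C_mul`, gen 19's Wuthrich
brick and part 1's `T = 0` dictionary. Nothing booked; labels UNCHANGED.

References: Wuthrich 2014 Thm. 16 [Wuthrich2014]; Delbourgo 2002 Thm. (A), (B) [Delbourgo2002];
Greenberg–Vatsal 2000 p. 4 [GreenbergVatsal2000]; Mazur–Tate–Teitelbaum 1986 §I.8, §I.13
[MazurTateTeitelbaum1986Invent]; Pal 2012 Thm. 3.2 [Pal2012]; Miller 2011 Def. 1.1 [Miller2011LMS];
gen 32 parts 5, 8. -/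

set_option autoImplicit false

noncomputable section

open scoped Classical MatrixGroups ModularForm NumberField

open CongruenceSubgroup IsDedekindDomain WeierstrassCurve NumberField
  Literature.NumberTheory.EllipticCurves
  Literature.NumberTheory.EllipticCurves.ModularForms
  Literature.NumberTheory.EllipticCurves.Rank1Residual
  Literature.NumberTheory.EllipticCurves.Rank1Residual.Typed
  Literature.NumberTheory.EllipticCurves.Delbourgo2002
  Literature.NumberTheory.GaloisRepresentations
  Summit.BirchSwinnertonDyer.Rank1Residual.AdditivePotMult
  Summit.BirchSwinnertonDyer.Rank1Residual.X1.MuLambda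
  Summit.BirchSwinnertonDyer.Rank1Residual.X1.RankOneParitySqueeze
  Summit.BirchSwinnertonDyer.Rank1Residual.X11a.LambdaNorm

namespace Summit.BirchSwinnertonDyer.Rank1Residual.Additive

section TwinsGord

open TameBranchMuPart TameBranchAnalyticSha

variable {W : WeierstrassCurve ℚ} [W.IsElliptic] [W.IsGloballyMinimal] {p : ℕ} [hp : Fact p.Prime]

/-! ### §3 X3♯(G-ord, `e = 2`) ∩ `I₀*` (`E[p]` reducible), every odd `p` -/

/-- **X3♯(G-ord) MASTER: the upper half WITH `ℓ` and its equality case** for the Wuthrich element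
(`ι g = u·ϖ·B^±_{(p−1)/2}(f♭, α)`), every odd `p`, rank 0, (B)-datum a binder (A175 / `mainTheorem_three`),
good-ordinary twist data. [cite: Wuthrich2014, Thm. 16 (p. 397)] [cite: Delbourgo2002, Theorem (B) (p. 40)]
[cite: GreenbergVatsal2000, p. 4] [cite: MazurTateTeitelbaum1986Invent, §I.8 (8.6), §I.13–I.14]
[cite: Miller2011LMS, §1 (arXiv:1010.2431 p. 3)] -/
theorem ClassX3Gord.padicVal_sha_add_le_shaAn_and_iff_rankZero
    (hWu : Wuthrich2014.thm16_halfEigenCharIdeal_dvd_cyclotomicPrime)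
    (hGZK : rank_eq_analyticRank_of_analyticRank_le_one) (hmod : hasEntireLFunction_rat)
    (hX : ClassX3Gord W p) (hp2 : p ≠ 2) (hr : W.analyticRank = 0)
    {Dh : PAdicHeightData W p} (hBcl : LeadingTermClauses W p Dh) {s : ℚ} (hs : shaAn W = (s : ℂ))
    (V : WeierstrassCurve ℚ) [V.IsElliptic] [V.IsGloballyMinimal] (C : VariableChange ℚ)
    (hC : C • V.quadraticTwist ((-1 : ℚ) ^ (p / 2) * p) = W) (hV : GoodOrd V p)
    {N : ℕ} [NeZero N] {f : CuspForm (Gamma0 N) 2} (hf : IsNewformOf V f)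
    (ϖ : ℚ) (hϖ : if Even (p / 2) then (ϖ : ℝ) * V.realPeriodRat = plusPeriod f
      else (ϖ : ℝ) * V.imaginaryPeriodRat = minusPeriod f)
    {κ : ZpExtension ℚ p} {γ : Field.absoluteGaloisGroup ℚ}
    (hκ : κ.IsCyclotomic) (hγ : κ.IsTopGenerator γ) (hγ' : IsCyclotomicVariable p γ)
    (D : W.SelmerDualData κ γ) :
    D.IsTorsion ∧ Finite (AddCommGroup.primaryComponent W.sha p) ∧
      ∃ (g : IwasawaAlgebra p) (u : ℤ_[p]ˣ) (ℓ : ℕ), g ∈ D.charIdeal ∧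
        iwasawaToPowerSeries p g = PowerSeries.C (((u : ℤ_[p]) : ℚ_[p]) * (ϖ : ℚ_[p])) *
          (if Even (p / 2) then padicLFunctionBranch f ((unitRoot V p : ℤ_[p]) : ℚ_[p]) (p / 2)
            else padicLFunctionMinusBranch f ((unitRoot V p : ℤ_[p]) : ℚ_[p]) (p / 2)) ∧
        ℓ ∣ p ^ 2 ∧ (ReductionNonAnomalous W p → ℓ = 1) ∧
        (padicValNat p (Nat.card (AddCommGroup.primaryComponent W.sha p)) : ℤ) + padicValNat p ℓ ≤
          padicValRat p s ∧
        (D.charIdeal = Ideal.span {g} ↔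
          (padicValNat p (Nat.card (AddCommGroup.primaryComponent W.sha p)) : ℤ) + padicValNat p ℓ =
            padicValRat p s) := by
  have hadd : Addv W p := hX.addv
  obtain ⟨hmw, -⟩ := hGZK W (by rw [hr]; norm_num)
  have hr0 : W.mordellWeilRank = 0 := by rw [hmw, hr]
  have hL : W.entireLFunction 1 ≠ 0 := (W.analyticRank_eq_zero_iff_holds (hmod W)).mp hr
  have hΩ : (W.realPeriodRat : ℂ) ≠ 0 := by exact_mod_cast W.realPeriodRat_pos_holds.ne'
  have hj := padicValRat_j_nonneg_of_typeGOrd W p hX.typeGOrd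
  have hord : IsOrdinaryAt V p :=
    isOrdinaryAt_of_goodOrd_or_mult_of_model_twist W V (pStar_ne_zero p) ⟨C, hC⟩ hj (Or.inl hV)
  haveI : Module.Finite (IwasawaAlgebra p) D.X :=
    SelmerDualData.module_finite_of_isCyclotomic (W := W) (κ := κ) hκ D hγ
  obtain ⟨hXt, g, hg, u, hι⟩ := isTorsion_and_exists_iota_eq_branch_of_wuthrichComponent W p
    (Wuthrich2014.charIdeal_dvd_padicLFunctionBranch_component_of_half hWu) hj hp2 V
    ⟨C, hC⟩ (Or.inl hV) hX.classX3.1 hκ hγ hγ' hf D ϖ hϖ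
  obtain ⟨q, u', hu'0, -, hLq, hA⟩ :=
    exists_rat_and_unit_constantCoeff_branch_eq hmod hp2 hadd V C hC hord hf ϖ hϖ
  have hq0 : q ≠ 0 := by
    intro h0'; apply hL
    have e : W.entireLFunction 1 = (q : ℂ) * (W.realPeriodRat : ℂ) := by rw [← hLq, div_mul_cancel₀ _ hΩ]
    rw [e, h0', Rat.cast_zero, zero_mul]
  have hS0 : PowerSeries.constantCoeff (PowerSeries.C (ϖ : ℚ_[p]) *
      (if Even (p / 2) then padicLFunctionBranch f ((unitRoot V p : ℤ_[p]) : ℚ_[p]) (p / 2)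
        else padicLFunctionMinusBranch f ((unitRoot V p : ℤ_[p]) : ℚ_[p]) (p / 2))) ≠ 0 := by
    rw [hA]; exact mul_ne_zero hu'0 (by exact_mod_cast hq0)
  have hdict := valuation_constantCoeff_branch_add_eq_padicValRat_shaAn_add hmod hGZK hp2 hadd hL V C hC
    hord hf ϖ hϖ hs
  obtain ⟨hfin, ℓ, hℓp, hℓ1, hle, hiff, -⟩ := padicVal_sha_add_le_and_iff_of_iota_eq_C_mul hr0 hBcl hκ hγ hγ' D
    hXt hg hι hS0 hdict
  exact ⟨hXt, hfin, g, u, ℓ, hg, hι, hℓp, hℓ1, hle, hiff⟩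

/-- **X3♯(G-ord): `BSD(E,p)` ⟹ THE WUTHRICH ELEMENT GENERATES `char_Λ X(E/ℚ_∞)`** (every odd `p`).
[cite: Wuthrich2014, Thm. 16 (p. 397)] [cite: Delbourgo2002, Theorem (B) (p. 40)]
[cite: Miller2011LMS, Def. 1.1 (arXiv:1010.2431 p. 3)] -/
theorem ClassX3Gord.charIdeal_eq_span_wuthrich_of_bsdp_rankZero
    (hWu : Wuthrich2014.thm16_halfEigenCharIdeal_dvd_cyclotomicPrime)
    (hGZK : rank_eq_analyticRank_of_analyticRank_le_one) (hmod : hasEntireLFunction_rat)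
    (hX : ClassX3Gord W p) (hp2 : p ≠ 2) (hr : W.analyticRank = 0) (hBSD : BSDp W p)
    {Dh : PAdicHeightData W p} (hBcl : LeadingTermClauses W p Dh)
    (V : WeierstrassCurve ℚ) [V.IsElliptic] [V.IsGloballyMinimal] (C : VariableChange ℚ)
    (hC : C • V.quadraticTwist ((-1 : ℚ) ^ (p / 2) * p) = W) (hV : GoodOrd V p)
    {N : ℕ} [NeZero N] {f : CuspForm (Gamma0 N) 2} (hf : IsNewformOf V f)
    (ϖ : ℚ) (hϖ : if Even (p / 2) then (ϖ : ℝ) * V.realPeriodRat = plusPeriod f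
      else (ϖ : ℝ) * V.imaginaryPeriodRat = minusPeriod f)
    {κ : ZpExtension ℚ p} {γ : Field.absoluteGaloisGroup ℚ}
    (hκ : κ.IsCyclotomic) (hγ : κ.IsTopGenerator γ) (hγ' : IsCyclotomicVariable p γ)
    (D : W.SelmerDualData κ γ) :
    ∃ (g : IwasawaAlgebra p) (u : ℤ_[p]ˣ), D.charIdeal = Ideal.span {g} ∧
      iwasawaToPowerSeries p g = PowerSeries.C (((u : ℤ_[p]) : ℚ_[p]) * (ϖ : ℚ_[p])) *
        (if Even (p / 2) then padicLFunctionBranch f ((unitRoot V p : ℤ_[p]) : ℚ_[p]) (p / 2)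
          else padicLFunctionMinusBranch f ((unitRoot V p : ℤ_[p]) : ℚ_[p]) (p / 2)) := by
  obtain ⟨-, -, s, hs, hsv⟩ := hBSD
  obtain ⟨-, -, g, u, ℓ, -, hι, -, -, hle, hiff⟩ := ClassX3Gord.padicVal_sha_add_le_shaAn_and_iff_rankZero hWu
    hGZK hmod hX hp2 hr hBcl hs V C hC hV hf ϖ hϖ hκ hγ hγ' D
  have hℓ0 : (padicValNat p ℓ : ℤ) = 0 := by
    have h0 : (0 : ℤ) ≤ padicValNat p ℓ := by exact_mod_cast Nat.zero_le _
    rw [hsv] at hle; linarith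
  exact ⟨g, u, hiff.mpr (by rw [hsv, hℓ0, add_zero]), hι⟩

/-- **X3♯(G-ord), OFF THE ANOMALOUS ROWS: THE WUTHRICH ELEMENT GENERATES ⟹ `BSD(E,p)`** (every odd `p`).
[cite: Wuthrich2014, Thm. 16 (p. 397)] [cite: Delbourgo2002, Theorem (B) (p. 40)]
[cite: Miller2011LMS, Def. 1.1 (arXiv:1010.2431 p. 3)] -/
theorem ClassX3Gord.bsdp_of_charIdeal_eq_span_wuthrich_rankZero
    (hWu : Wuthrich2014.thm16_halfEigenCharIdeal_dvd_cyclotomicPrime)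
    (hGZK : rank_eq_analyticRank_of_analyticRank_le_one) (hmod : hasEntireLFunction_rat)
    (hX : ClassX3Gord W p) (hp2 : p ≠ 2) (hr : W.analyticRank = 0) (hna : ReductionNonAnomalous W p)
    {Dh : PAdicHeightData W p} (hBcl : LeadingTermClauses W p Dh) {s : ℚ} (hs : shaAn W = (s : ℂ))
    (V : WeierstrassCurve ℚ) [V.IsElliptic] [V.IsGloballyMinimal] (C : VariableChange ℚ)
    (hC : C • V.quadraticTwist ((-1 : ℚ) ^ (p / 2) * p) = W) (hV : GoodOrd V p)
    {N : ℕ} [NeZero N] {f : CuspForm (Gamma0 N) 2} (hf : IsNewformOf V f)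
    (ϖ : ℚ) (hϖ : if Even (p / 2) then (ϖ : ℝ) * V.realPeriodRat = plusPeriod f
      else (ϖ : ℝ) * V.imaginaryPeriodRat = minusPeriod f)
    (hMC : ∀ (κ : ZpExtension ℚ p) (γ : Field.absoluteGaloisGroup ℚ),
      κ.IsCyclotomic → κ.IsTopGenerator γ → IsCyclotomicVariable p γ → ∀ (D : W.SelmerDualData κ γ)
      (g : IwasawaAlgebra p) (u : ℤ_[p]ˣ), g ∈ D.charIdeal →
        iwasawaToPowerSeries p g = PowerSeries.C (((u : ℤ_[p]) : ℚ_[p]) * (ϖ : ℚ_[p])) *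
          (if Even (p / 2) then padicLFunctionBranch f ((unitRoot V p : ℤ_[p]) : ℚ_[p]) (p / 2)
            else padicLFunctionMinusBranch f ((unitRoot V p : ℤ_[p]) : ℚ_[p]) (p / 2)) →
        D.charIdeal = Ideal.span {g}) :
    BSDp W p := by
  obtain ⟨hmw, -⟩ := hGZK W (by rw [hr]; norm_num)
  obtain ⟨κ₀, γ₀, hκ₀, hγ₀, hγ₀', D₀, -, -⟩ := exists_cyclotomic_dualData_generator W p
  obtain ⟨-, hfin, g, u, ℓ, hg, hι, -, hℓ1, -, hiff⟩ := ClassX3Gord.padicVal_sha_add_le_shaAn_and_iff_rankZero hWu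
    hGZK hmod hX hp2 hr hBcl hs V C hC hV hf ϖ hϖ hκ₀ hγ₀ hγ₀' D₀
  have heq := hiff.mp (hMC κ₀ γ₀ hκ₀ hγ₀ hγ₀' D₀ g u hg hι)
  rw [hℓ1 hna, padicValNat_one_right, Nat.cast_zero, add_zero] at heq
  exact ⟨hmw, hfin, s, hs, heq.symm⟩

end TwinsGord

end Summit.BirchSwinnertonDyer.Rank1Residual.Additive

end
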